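import Literature.Analysis.InnerProduct.HigherLensSpaceHomogeneousRigidity
import HarnessLib

/-!
# The multiplicities `dim E_k(L(q : p₀, …, p_n))` are invariants of Ikeda's equivalence class of the weights — congruence mod `q`,
# permutations, signs `εᵢ = ±1`, a common unit multiple `l` (Ikeda–Yamamoto Proposition 1.1 / Ikeda Theorem 2.1: equivalent ⟹
# isometric ⟹ isospectral); homogeneous = equivalent to `(1, …, 1)`; Corollary 3.4 as an EQUIVALENCE of weight systems

Layer `Literature/Analysis/InnerProduct`, namespace `Literature.Analysis.InnerProduct`; lane `lit-hodgefound`, prover seat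
`lit-hodgefound-p06`, generation 44, self-proposed row g44-#12 — the sequel BY IMPORT of rows g44-#11 (`HigherLensSpaceHomogeneousRigidity.lean`:
COROLLARY 3.4 in arithmetic form, `dvd_sub_or_dvd_add_of_lensSpaceMultiplicity_eq`), g44-#2 (`HigherLensSpaceSpectrum.lean`: the multiplicity
formula (3.10) `lensSpaceMultiplicity_eq_sum_sphereHarmonicCharacter` and `mk_sphereMonomialCharacter` — `∑χ_kz^k = ∏ᵢ∑_jU_j(cᵢ)zʲ`) and g44-#1
(`LensWeightsEquivalent q p s` = "`∃ l, εᵢ ∈ {±1}, σ` with `p_{σ(i)} ≡ εᵢlsᵢ (mod q)`", the criterion of Theorem 2.1). The tree used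
`LensWeightsEquivalent` only negatively (row g44-#3: `L(11 : 1, 2, 4)` and `L(11 : 1, 2, 8)` are NOT equivalent though isospectral); this file
proves the positive direction — equivalent weight systems give the same `dim E_k` for every `k` — for lens spaces of every dimension, and
restates Corollary 3.4 as "isospectral to a homogeneous lens space ⟹ equivalent to it". THEOREMS ONLY (no definition, no instance, no
notation, no named fact).

## Sources, verbatim (held texts `paper:doi-10-18910-4811` p. 449 = p0004, `paper:doi-10-24033-asens-1384` p. 309 = p0008)

A. Ikeda, Y. Yamamoto, *On the spectra of 3-dimensional lens spaces*, Osaka J. Math. **16** (1979) 447–469: "**Proposition 1.1.** Let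
`L(q : p₀, ⋯, p_n)` and `L(q : p′₀, ⋯, p′_n)` be lens spaces. Suppose there exist an integer `l` and numbers `εᵢ ∈ {−1, 1}` (`i = 0, 1, ⋯, n`)
such that `(p′₀, ⋯, p′_n)` is a permutation of `(ε₀lp₀, ⋯, ε_nlp_n) (mod q)`. Then `L(q : p₀, ⋯, p_n)` is isometric to `L(q : p′₀, ⋯, p′_n)`. …
the lens space `L(q : lp₀, ⋯, lp_n)` is identical to `L(q : p₀, ⋯, p_n)` … **Proposition 1.2** (see J.A. Wolf [13]). The riemannian manifold
`L(q : p₀, ⋯, p_n)` is homogeneous if and only if for any `i` and `j`, `0 ≤ i, j ≤ n`, it satisfies either `pᵢ ≡ p_j (mod q)` or `pᵢ ≡ −p_j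
(mod q)`. Furthermore two homogeneous lens spaces with same [order `q` and dimension] are isometric to each other." (p0004); "**Corollary 3.4.**
Assume `L(q : p₀, ⋯, p_n)` is a homogeneous lens space and isospectral to `L(q : p′₀, ⋯, p′_n)`. Then `L(q : p′₀, ⋯, p′_n)` is homogeneous
and isometric to `L(q : p₀, ⋯, p_n)`." (p0008). A. Ikeda, *On lens spaces which are isospectral but not isometric*, Ann. Sci. ÉNS (4) **13**
(1980), p. 309 (p0008): "**THEOREM 2.1** (cf. [2], [6]). Let `L = L(q : p₁, …, p_n)` and `L′ = L(q : s₁, …, s_n)` be lens spaces. Then the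
following assertions are equivalent: 1. `L` is isometric to `L′`; 2. `L` is diffeomorphic to `L′`; 3. `L` is homeomorphic to `L′`; 4. there
is a number `l` and there are numbers `eᵢ ∈ {−1, 1}` such that `(p₁, …, p_n)` is a permutation of `(e₁ls₁, …, e_nls_n) (mod q)`."

## The proof as formalised (through the multiplicity formula (3.10))

By (3.10), `dim E_k(L(q : p)) = (1/q)∑_{l=0}^{q−1}χ̃_k(cos(2πlp₀/q), …, cos(2πlp_n/q))`, where (§1) `χ̃_k` is a symmetric function of the
cosines (`mk_sphereMonomialCharacter`: `∑χ_kz^k = ∏ᵢ∑_jU_j(cᵢ)zʲ` and `Fintype.prod_equiv`). §2: congruent weights give the same cosines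
(`cos(2πa/q) = cos(2πb/q)` for `a ≡ b (mod q)`); permuted weights permute the cosines; signs do not change them (`cos` even); a unit
multiple `u` re-indexes the sum over `l` by `l ↦ lu mod q`, a bijection of `{0, …, q−1}` (`Nat.ModEq.cancel_right_of_coprime`). In an
equivalence of weight systems with the `pᵢ` prime to `q` the multiplier is automatically a unit. §3: Proposition 1.2 ⟺ equivalence to
`(1, …, 1)`; two homogeneous systems `pᵢ ≡ εᵢp₀`, `p′ᵢ ≡ ε′ᵢp′₀` satisfy `p′ᵢ ≡ (ε′ᵢεᵢ)(p′₀v)pᵢ` with `vp₀ ≡ 1`; with row g44-#11 this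
gives Corollary 3.4 as an equivalence.

## What is proved

* §1 **`sphereMonomialCharacter_comp_equiv`**, **`sphereHarmonicCharacter_comp_equiv`** (symmetry of `χ_k`, `χ̃_k`).
* §2 **`lensSpaceMultiplicity_congr`** (mod `q`), **`lensSpaceMultiplicity_comp_equiv`** (permutations), **`lensSpaceMultiplicity_sign_mul`**
  (signs), **`lensSpaceMultiplicity_unit_mul`** (unit multiples), `LensWeightsEquivalent.isCoprime`,
  **`LensWeightsEquivalent.lensSpaceMultiplicity_eq`** (EQUIVALENT WEIGHT SYSTEMS ARE ISOSPECTRAL, every dimension).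
* §3 **`lensWeightsEquivalent_const_one_iff`** (Proposition 1.2 ⟺ equivalence to `(1, …, 1)`), `LensWeightsEquivalent.lensSpaceMultiplicity_eq_const_one`,
  **`lensWeightsEquivalent_of_forall_dvd_sub_or_dvd_add`** (two homogeneous systems are equivalent),
  **`lensWeightsEquivalent_of_lensSpaceMultiplicity_eq`** (COROLLARY 3.4: isospectral to a homogeneous lens space ⟹ equivalent to it).

## References

* [IkedaYamamoto1979] A. Ikeda, Y. Yamamoto, *On the spectra of 3-dimensional lens spaces*, Osaka J. Math. 16 (1979) 447–469, §1
  Propositions 1.1, 1.2, §2 Corollary 2.3, §3 (3.1), (3.4), (3.10), Corollary 3.4, §4 (the normalisation `p₀ = 1`).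
* [Ikeda1980] A. Ikeda, *On lens spaces which are isospectral but not isometric*, Ann. Sci. ÉNS (4) 13 (1980) 303–315, §2 Theorem 2.1,
  (2.3).
-/

noncomputable section

namespace Literature.Analysis.InnerProduct

open Finset Polynomial.Chebyshev
open _root_.Real

/-! ### §1 `χ_k`, `χ̃_k` are symmetric functions of the rotation cosines -/

/-- **`χ_k` is a symmetric function of the rotation cosines**: `χ_k(c ∘ σ) = χ_k(c)` for every permutation `σ` (the generating
series `∑χ_kz^k = ∏ᵢ(1 − 2cᵢz + z²)^{−1}` is a symmetric product). [cite: IkedaYamamoto1979, §3 (3.4); Ikeda1980, §2 (2.3)] -/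
theorem sphereMonomialCharacter_comp_equiv {n : ℕ} (σ : Equiv.Perm (Fin n)) (c : Fin n → ℝ) (k : ℕ) :
    sphereMonomialCharacter n k (fun i ↦ c (σ i)) = sphereMonomialCharacter n k c := by
  have h1 := mk_sphereMonomialCharacter (fun i ↦ c (σ i))
  have h2 := mk_sphereMonomialCharacter c
  have h3 : (∏ i, PowerSeries.mk (fun j : ℕ ↦ (U ℝ j).eval (c (σ i)))) = ∏ i, PowerSeries.mk (fun j : ℕ ↦ (U ℝ j).eval (c i)) :=
    Fintype.prod_equiv σ _ _ fun i ↦ rfl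
  have h := congrArg (PowerSeries.coeff k) (h1.trans (h3.trans h2.symm))
  simpa [PowerSeries.coeff_mk] using h

/-- **`χ̃_k(c ∘ σ) = χ̃_k(c)`**. [cite: IkedaYamamoto1979, §3 (3.1), (3.4)] -/
theorem sphereHarmonicCharacter_comp_equiv {n : ℕ} (σ : Equiv.Perm (Fin n)) (c : Fin n → ℝ) (k : ℕ) :
    sphereHarmonicCharacter n k (fun i ↦ c (σ i)) = sphereHarmonicCharacter n k c := by
  rw [sphereHarmonicCharacter_eq, sphereHarmonicCharacter_eq, sphereMonomialCharacter_comp_equiv, sphereMonomialCharacter_comp_equiv]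

/-! ### §2 `dim E_k(L(q : p))` is invariant under congruence, permutation, signs and common unit multiples of the weights -/

section Invariance

variable {q : ℕ}

/-- `cos(2πa/q) = cos(2πb/q)` for `a ≡ b (mod q)`. [folklore] -/
private theorem cos_two_pi_mul_div_congr {a b : ℤ} (h : a ≡ b [ZMOD q]) :
    Real.cos (2 * π * (a : ℝ) / q) = Real.cos (2 * π * (b : ℝ) / q) := by
  rcases eq_or_ne q 0 with rfl | hq
  · simp
  obtain ⟨m, hm⟩ := (Int.modEq_iff_dvd.mp h.symm)
  have hq0 : (q : ℝ) ≠ 0 := Nat.cast_ne_zero.mpr hq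
  have e : 2 * π * (a : ℝ) / q = 2 * π * (b : ℝ) / q + (m : ℤ) * (2 * π) := by
    have : (a : ℝ) = b + q * m := by
      have h' : a = b + q * m := by linarith
      exact_mod_cast h'
    rw [this, show 2 * π * ((b : ℝ) + q * m) / q = 2 * π * (b : ℝ) / q + 2 * π * m * ((q : ℝ) / q) by ring, div_self hq0]
    ring
  rw [e, Real.cos_add_int_mul_two_pi]

/-- **`dim E_k(L(q : p))` depends only on the weights mod `q`**: `pᵢ ≡ sᵢ (mod q)` for all `i` ⟹ equal multiplicities (the lens
spaces coincide). [cite: IkedaYamamoto1979, §1 (the action `g = diag(γ^{p₀}, …, γ^{p_n})` depends on `pᵢ mod q`) and (3.10)] -/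
theorem lensSpaceMultiplicity_congr (hq : q ≠ 0) {n : ℕ} {p s : Fin (n + 1) → ℤ} (h : ∀ i, p i ≡ s i [ZMOD q]) (k : ℕ) :
    lensSpaceMultiplicity q p k = lensSpaceMultiplicity q s k := by
  have e := lensSpaceMultiplicity_eq_sum_sphereHarmonicCharacter q hq p k
  have hc : ∀ l : ℕ, (fun i ↦ Real.cos (2 * π * l * p i / q)) = fun i ↦ Real.cos (2 * π * l * s i / q) := by
    intro l
    funext i
    have h1 := cos_two_pi_mul_div_congr (q := q) ((h i).mul_left (l : ℤ))
    push_cast at h1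
    rw [show 2 * π * (l : ℝ) * (p i : ℝ) / q = 2 * π * ((l : ℝ) * (p i : ℝ)) / q by ring,
      show 2 * π * (l : ℝ) * (s i : ℝ) / q = 2 * π * ((l : ℝ) * (s i : ℝ)) / q by ring, h1]
  simp only [hc] at e
  rw [← lensSpaceMultiplicity_eq_sum_sphereHarmonicCharacter q hq s k] at e
  exact_mod_cast e

/-- **Permuting the weights does not change `dim E_k`**: `L(q : p_{σ(0)}, …, p_{σ(n)})` and `L(q : p₀, …, p_n)` have the same
multiplicities (by (3.10) and the symmetry of `χ̃_k`). [cite: IkedaYamamoto1979, Proposition 1.1 (the isometry for a permutation) with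
Corollary 2.3, (3.10); Ikeda1980, Theorem 2.1] -/
theorem lensSpaceMultiplicity_comp_equiv (hq : q ≠ 0) {n : ℕ} (σ : Equiv.Perm (Fin (n + 1))) (p : Fin (n + 1) → ℤ) (k : ℕ) :
    lensSpaceMultiplicity q (fun i ↦ p (σ i)) k = lensSpaceMultiplicity q p k := by
  have e := lensSpaceMultiplicity_eq_sum_sphereHarmonicCharacter q hq (fun i ↦ p (σ i)) k
  have hc : ∀ l : ℕ, sphereHarmonicCharacter (n + 1) k (fun i ↦ Real.cos (2 * π * l * p (σ i) / q)) =
      sphereHarmonicCharacter (n + 1) k (fun i ↦ Real.cos (2 * π * l * p i / q)) := fun l ↦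
    sphereHarmonicCharacter_comp_equiv σ (fun i ↦ Real.cos (2 * π * l * p i / q)) k
  simp only [hc] at e
  rw [← lensSpaceMultiplicity_eq_sum_sphereHarmonicCharacter q hq p k] at e
  exact_mod_cast e

/-- **Changing signs of the weights does not change `dim E_k`**: `L(q : ε₀p₀, …, ε_np_n)`, `εᵢ = ±1` (by (3.10): `cos` is even).
[cite: IkedaYamamoto1979, Proposition 1.1 with Corollary 2.3, (3.10); Ikeda1980, Theorem 2.1] -/
theorem lensSpaceMultiplicity_sign_mul (hq : q ≠ 0) {n : ℕ} {e : Fin (n + 1) → ℤ} (he : ∀ i, e i = 1 ∨ e i = -1)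
    (p : Fin (n + 1) → ℤ) (k : ℕ) :
    lensSpaceMultiplicity q (fun i ↦ e i * p i) k = lensSpaceMultiplicity q p k := by
  have h := lensSpaceMultiplicity_eq_sum_sphereHarmonicCharacter q hq (fun i ↦ e i * p i) k
  have hc : ∀ l : ℕ, (fun i ↦ Real.cos (2 * π * l * ((e i * p i : ℤ) : ℝ) / q)) = fun i ↦ Real.cos (2 * π * l * p i / q) := by
    intro l
    funext i
    rcases he i with h1 | h1
    · rw [h1, one_mul]
    · rw [h1, show 2 * π * l * (((-1) * p i : ℤ) : ℝ) / q = -(2 * π * l * p i / q) by push_cast; ring, Real.cos_neg]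
  simp only [hc] at h
  rw [← lensSpaceMultiplicity_eq_sum_sphereHarmonicCharacter q hq p k] at h
  exact_mod_cast h

/-- A natural representative of a unit mod `q` is a unit mod `q`. [folklore] -/
private theorem coprime_toNat_emod (hq : q ≠ 0) {u : ℤ} (hu : IsCoprime u q) :
    Nat.Coprime (u % q).toNat q ∧ (((u % q).toNat : ℕ) : ℤ) = u % q := by
  have hq0 : (0 : ℤ) < q := by exact_mod_cast Nat.pos_of_ne_zero hq
  have hw : (((u % q).toNat : ℕ) : ℤ) = u % q := Int.toNat_of_nonneg (Int.emod_nonneg u hq0.ne')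
  refine ⟨?_, hw⟩
  have h1 : IsCoprime (u % q) (q : ℤ) := by
    have e : u % q = u + q * (-(u / q)) := by
      have := Int.emod_add_mul_ediv u q
      linarith
    rw [e]
    exact hu.add_mul_left_left _
  rw [← hw] at h1
  exact Nat.isCoprime_iff_coprime.mp h1

/-- **A common unit multiple of the weights does not change `dim E_k`**: `L(q : up₀, …, up_n)`, `u` prime to `q` — in (3.10) the map
`l ↦ lu` permutes the residues mod `q` ("choosing a suitable generator for its defining cyclic group `G`"). [cite: IkedaYamamoto1979,
Proposition 1.1 (the integer `l`) with (3.10), §4 ("Choosing a suitable generator … we may assume `p₀ = 1`"); Ikeda1980, Theorem 2.1] -/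
theorem lensSpaceMultiplicity_unit_mul (hq : q ≠ 0) {n : ℕ} {u : ℤ} (hu : IsCoprime u q) (p : Fin (n + 1) → ℤ) (k : ℕ) :
    lensSpaceMultiplicity q (fun i ↦ u * p i) k = lensSpaceMultiplicity q p k := by
  obtain ⟨hcop, hw⟩ := coprime_toNat_emod hq hu
  set w : ℕ := (u % q).toNat with hwdef
  have hwu : (w : ℤ) ≡ u [ZMOD q] := by rw [hw]; exact Int.mod_modEq u q
  have e1 := lensSpaceMultiplicity_eq_sum_sphereHarmonicCharacter q hq (fun i ↦ u * p i) k
  have e2 := lensSpaceMultiplicity_eq_sum_sphereHarmonicCharacter q hq p k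
  -- reindex `l ↦ lw mod q`
  have hmaps : ∀ l ∈ range q, l * w % q ∈ range q := fun l _ ↦ mem_range.mpr (Nat.mod_lt _ (Nat.pos_of_ne_zero hq))
  have hinj : Set.InjOn (fun l : ℕ ↦ l * w % q) (range q : Finset ℕ) := by
    intro l₁ h₁ l₂ h₂ h12
    have hm : l₁ * w ≡ l₂ * w [MOD q] := h12
    exact Nat.ModEq.eq_of_lt_of_lt (Nat.ModEq.cancel_right_of_coprime hcop.symm.gcd_eq_one hm)
      (mem_range.mp (Finset.mem_coe.mp h₁)) (mem_range.mp (Finset.mem_coe.mp h₂))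
  have key : ∑ l ∈ range q, sphereHarmonicCharacter (n + 1) k (fun i ↦ Real.cos (2 * π * l * ((u * p i : ℤ) : ℝ) / q)) =
      ∑ m ∈ range q, sphereHarmonicCharacter (n + 1) k (fun i ↦ Real.cos (2 * π * m * p i / q)) := by
    refine Finset.sum_nbij (fun l : ℕ ↦ l * w % q) hmaps hinj
      (Finset.surjOn_of_injOn_of_card_le _ (fun l hl ↦ Finset.mem_coe.mpr (hmaps l (Finset.mem_coe.mp hl))) hinj le_rfl)
      fun l _ ↦ ?_
    congr 1
    funext i
    have hcong : (l : ℤ) * (u * p i) ≡ (((l * w % q : ℕ) : ℤ)) * p i [ZMOD q] := by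
      have h1 : (((l * w % q : ℕ) : ℤ)) ≡ (l : ℤ) * w [ZMOD q] := by
        rw [Int.natCast_mod, Int.natCast_mul]
        exact Int.mod_modEq _ _
      have h2 := (h1.mul_right (p i)).symm
      have h3 : (l : ℤ) * (u * p i) ≡ (l : ℤ) * w * p i [ZMOD q] := by
        rw [show (l : ℤ) * (u * p i) = (l : ℤ) * u * p i by ring]
        exact ((hwu.symm.mul_left (l : ℤ)).mul_right (p i))
      exact h3.trans h2
    have eL : 2 * π * (l : ℝ) * ((u * p i : ℤ) : ℝ) / q = 2 * π * (((l : ℤ) * (u * p i) : ℤ) : ℝ) / q := by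
      push_cast; ring
    have eR : 2 * π * ((l * w % q : ℕ) : ℝ) * (p i : ℝ) / q = 2 * π * (((((l * w % q : ℕ) : ℤ)) * p i : ℤ) : ℝ) / q := by
      rw [Int.cast_mul, Int.cast_natCast]; ring
    rw [eL, eR]
    exact cos_two_pi_mul_div_congr hcong
  rw [key, ← e2] at e1
  exact_mod_cast e1

/-- In an equivalence `p_{σ(i)} ≡ εᵢ·l·sᵢ (mod q)` of weight systems with the `pᵢ` prime to `q`, the multiplier `l` is prime to `q`.
[cite: IkedaYamamoto1979, Proposition 1.1; Ikeda1980, Theorem 2.1 ("there are a number `l` [prime to `q`] and numbers `eᵢ ∈ {−1, 1}`")] -/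
theorem LensWeightsEquivalent.isCoprime {n : ℕ} {p s : Fin (n + 1) → ℤ} (h : LensWeightsEquivalent q p s)
    (hp : ∀ i, IsCoprime (p i) q) : ∃ l : ℤ, IsCoprime l q ∧ ∃ e : Fin (n + 1) → ℤ, (∀ i, e i = 1 ∨ e i = -1) ∧
      ∃ σ : Equiv.Perm (Fin (n + 1)), ∀ i, p (σ i) ≡ e i * l * s i [ZMOD q] := by
  obtain ⟨l, e, he, σ, hσ⟩ := h
  refine ⟨l, ?_, e, he, σ, hσ⟩
  obtain ⟨m, hm⟩ := Int.modEq_iff_dvd.mp (hσ 0).symm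
  have h1 : IsCoprime (e 0 * l * s 0) q := by
    have e1 : e 0 * l * s 0 = p (σ 0) + q * (-m) := by linarith
    rw [e1]
    exact (hp (σ 0)).add_mul_left_left (-m)
  exact h1.of_mul_left_left.of_mul_left_right

/-- **ISOMETRIC LENS SPACES ARE ISOSPECTRAL — the converse direction of Ikeda's Theorem 2.1 / Proposition 1.1 at the level of
multiplicities**: if `(p₀, …, p_n)` and `(s₀, …, s_n)` are equivalent (`p_{σ(i)} ≡ εᵢ·l·sᵢ (mod q)`: "Then `L(q : p₀, ⋯, p_n)` is isometric
to `L(q : p′₀, ⋯, p′_n)`"), then `dim E_k(L(q : p)) = dim E_k(L(q : s))` for every `k`. [cite: IkedaYamamoto1979, Proposition 1.1 and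
Corollary 2.3; Ikeda1980, Theorem 2.1] -/
theorem LensWeightsEquivalent.lensSpaceMultiplicity_eq (hq : q ≠ 0) {n : ℕ} {p s : Fin (n + 1) → ℤ}
    (h : LensWeightsEquivalent q p s) (hp : ∀ i, IsCoprime (p i) q) (k : ℕ) :
    lensSpaceMultiplicity q p k = lensSpaceMultiplicity q s k := by
  obtain ⟨l, hl, e, he, σ, hσ⟩ := h.isCoprime hp
  calc lensSpaceMultiplicity q p k = lensSpaceMultiplicity q (fun i ↦ p (σ i)) k := (lensSpaceMultiplicity_comp_equiv hq σ p k).symm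
    _ = lensSpaceMultiplicity q (fun i ↦ e i * (l * s i)) k :=
        lensSpaceMultiplicity_congr hq (fun i ↦ by rw [← mul_assoc]; exact hσ i) k
    _ = lensSpaceMultiplicity q (fun i ↦ l * s i) k := lensSpaceMultiplicity_sign_mul hq he _ k
    _ = lensSpaceMultiplicity q s k := lensSpaceMultiplicity_unit_mul hq hl s k

end Invariance

/-! ### §3 Homogeneous weights = weights equivalent to `(1, …, 1)`; Corollary 3.4 in the language of equivalence -/

section Homogeneous

variable {q : ℕ}

/-- **HOMOGENEOUS = EQUIVALENT TO `(1, …, 1)`**: `(p₀, …, p_n)` is equivalent to `(1, …, 1)` iff `pᵢ ≡ ±p_j (mod q)` for all `i, j`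
(Proposition 1.2: "homogeneous if and only if … either `pᵢ ≡ p_j (mod q)` or `pᵢ ≡ −p_j (mod q)`"; `L(q : 1, …, 1) = S^{2n+1}/⟨γ·1⟩`).
[cite: IkedaYamamoto1979, Proposition 1.2 and Proposition 1.1] -/
theorem lensWeightsEquivalent_const_one_iff {n : ℕ} (p : Fin (n + 1) → ℤ) :
    LensWeightsEquivalent q p (fun _ ↦ 1) ↔ ∀ i j, (q : ℤ) ∣ p i - p j ∨ (q : ℤ) ∣ p i + p j := by
  constructor
  · rintro ⟨l, e, he, σ, hσ⟩ i j
    have hi := hσ (σ.symm i)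
    have hj := hσ (σ.symm j)
    rw [Equiv.apply_symm_apply, mul_one] at hi hj
    have hi' := Int.modEq_iff_dvd.mp hi.symm
    have hj' := Int.modEq_iff_dvd.mp hj.symm
    rcases he (σ.symm i) with h1 | h1 <;> rcases he (σ.symm j) with h2 | h2 <;> rw [h1] at hi' <;> rw [h2] at hj'
    · left
      have := dvd_sub hi' hj'
      rwa [show p i - 1 * l - (p j - 1 * l) = p i - p j by ring] at this
    · right
      have := dvd_add hi' hj'
      rwa [show p i - 1 * l + (p j - (-1) * l) = p i + p j by ring] at this
    · right
      have := dvd_add hi' hj'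
      rwa [show p i - (-1) * l + (p j - 1 * l) = p i + p j by ring] at this
    · left
      have := dvd_sub hi' hj'
      rwa [show p i - (-1) * l - (p j - (-1) * l) = p i - p j by ring] at this
  · intro h
    classical
    refine ⟨p 0, fun i ↦ if (q : ℤ) ∣ p i - p 0 then 1 else -1, fun i ↦ by dsimp only; split_ifs <;> simp, Equiv.refl _,
      fun i ↦ ?_⟩
    simp only [Equiv.refl_apply, mul_one]
    split_ifs with hi
    · rw [one_mul]
      exact Int.modEq_iff_dvd.mpr (dvd_sub_comm.mp hi)
    · rcases h i 0 with h' | h'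
      · exact absurd h' hi
      · refine Int.modEq_iff_dvd.mpr ?_
        rwa [show (-1) * p 0 - p i = -(p i + p 0) by ring, dvd_neg]

/-- A homogeneous lens space `L(q : p)` (weights prime to `q`, equivalent to `(1, …, 1)`) has the multiplicities of `L(q : 1, …, 1)`.
[cite: IkedaYamamoto1979, Propositions 1.1–1.2 with Corollary 2.3] -/
theorem LensWeightsEquivalent.lensSpaceMultiplicity_eq_const_one (hq : q ≠ 0) {n : ℕ} {p : Fin (n + 1) → ℤ}
    (h : LensWeightsEquivalent q p (fun _ ↦ 1)) (hp : ∀ i, IsCoprime (p i) q) (k : ℕ) :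
    lensSpaceMultiplicity q p k = lensSpaceMultiplicity q (fun _ : Fin (n + 1) ↦ (1 : ℤ)) k :=
  h.lensSpaceMultiplicity_eq hq hp k

/-- **Two homogeneous weight systems mod `q` are equivalent** ("two homogeneous lens spaces with same [`q`, `n`] are isometric to
each other"): `pᵢ ≡ ±p_j`, `p′ᵢ ≡ ±p′_j` for all `i, j`, `p₀` prime to `q` ⟹ `p′ᵢ ≡ (ε′ᵢεᵢ)(p′₀p₀^{−1})pᵢ (mod q)`. [cite: IkedaYamamoto1979,
Proposition 1.2 ("Furthermore two homogeneous lens spaces … are isometric to each other") with Proposition 1.1] -/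
theorem lensWeightsEquivalent_of_forall_dvd_sub_or_dvd_add {n : ℕ} {p p' : Fin (n + 1) → ℤ} (hp : IsCoprime (p 0) q)
    (hhom : ∀ i j, (q : ℤ) ∣ p i - p j ∨ (q : ℤ) ∣ p i + p j) (hhom' : ∀ i j, (q : ℤ) ∣ p' i - p' j ∨ (q : ℤ) ∣ p' i + p' j) :
    LensWeightsEquivalent q p' p := by
  classical
  obtain ⟨v, t, hvt⟩ := hp
  -- signs: `r i ≡ ε i · r 0`
  have hsign : ∀ (r : Fin (n + 1) → ℤ), (∀ i j, (q : ℤ) ∣ r i - r j ∨ (q : ℤ) ∣ r i + r j) →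
      ∃ ε : Fin (n + 1) → ℤ, (∀ i, ε i = 1 ∨ ε i = -1) ∧ ∀ i, (q : ℤ) ∣ r i - ε i * r 0 := by
    intro r hr
    refine ⟨fun i ↦ if (q : ℤ) ∣ r i - r 0 then 1 else -1, fun i ↦ ?_, fun i ↦ ?_⟩
    · dsimp only
      split_ifs <;> simp
    · dsimp only
      split_ifs with hi
      · rwa [one_mul]
      · rcases hr i 0 with h' | h'
        · exact absurd h' hi
        · rwa [show r i - (-1) * r 0 = r i + r 0 by ring]
  obtain ⟨e, he, h1⟩ := hsign p hhom
  obtain ⟨e', he', h2⟩ := hsign p' hhom'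
  refine ⟨p' 0 * v, fun i ↦ e' i * e i, fun i ↦ ?_, Equiv.refl _, fun i ↦ ?_⟩
  · rcases he i with h | h <;> rcases he' i with h' | h' <;> simp [h, h']
  · rw [Equiv.refl_apply]
    have hee : e i * e i = 1 := by rcases he i with h | h <;> simp [h]
    refine Int.modEq_iff_dvd.mpr ?_
    obtain ⟨a, ha⟩ := h1 i
    obtain ⟨b, hb⟩ := h2 i
    exact ⟨-b - e' i * p' 0 * t + e' i * e i * p' 0 * v * a, by
      linear_combination (e' i * e i * p' 0 * v) * ha + (e' i * p' 0 * v * p 0) * hee + (e' i * p' 0) * hvt - hb⟩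

/-- **COROLLARY 3.4 IN THE LANGUAGE OF THEOREM 2.1 / PROPOSITION 1.1, EVERY DIMENSION, EVERY `q`**: if `L(q : p₀, …, p_n)` is
homogeneous (its weights equivalent to `(1, …, 1)`) and the lens space `L(q : p′₀, …, p′_n)` (all weights prime to `q`) is isospectral
to it (`dim E_k` equal for all `k`), then `(p′ᵢ)` is EQUIVALENT to `(pᵢ)` — "`L(q : p′₀, ⋯, p′_n)` is homogeneous and isometric to `L(q :
p₀, ⋯, p_n)`" (row g44-#11 supplies homogeneity of `p′`; equivalence is the isometry criterion of Proposition 1.1 / Theorem 2.1).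
[cite: IkedaYamamoto1979, Corollary 3.4, Propositions 1.1–1.2; Ikeda1980, Theorem 2.1] -/
theorem lensWeightsEquivalent_of_lensSpaceMultiplicity_eq {n : ℕ} {p p' : Fin (n + 1) → ℤ} (hp : ∀ i, IsCoprime (p i) q)
    (hp' : ∀ i, IsCoprime (p' i) q) (hhom : LensWeightsEquivalent q p (fun _ ↦ 1))
    (h : ∀ k : ℕ, lensSpaceMultiplicity q p k = lensSpaceMultiplicity q p' k) : LensWeightsEquivalent q p' p := by
  have hhom1 := (lensWeightsEquivalent_const_one_iff p).mp hhom
  have hhom2 := dvd_sub_or_dvd_add_of_lensSpaceMultiplicity_eq hp hp' hhom1 h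
  exact lensWeightsEquivalent_of_forall_dvd_sub_or_dvd_add (hp 0) hhom1 hhom2

end Homogeneous

end Literature.Analysis.InnerProduct
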